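import Summits.BirchSwinnertonDyer.BirchSwinnertonDyer.Theorems.KatoDescentPotSupersingularKatoFiniteLevelStrictLocalH0
import HarnessLib

/-!
# Kato's (14.9.3) at finite level, part 15: the bound with EVERY factor a classical finite group —
# `#H¹_ℛ(K, E[p^k]) ≤ #Ш(E/K)[p^∞] · ∏_{v∈T∖P} #E(K_v)[p^∞] · ∏_{v∈P} #𝓚_v` for `k ≥ k₀`
# (route `KatoDescentPotSupersingular` / `…Tame…`, crux M = stmt-BirchSwinnertonDyer-19196 `ReducibleKatoMember`; route-free helper)

Seat `bsd-potss-rkm` g17 (prover; cell `bsd-potss`), item stmt-BirchSwinnertonDyer-19196 (`--supports … --as helper`; closes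
nothing).  HONEST FRAMING: BSD is not proved by any of this; nothing is booked; theorems only (no definition, no named fact).

Parts 12 (`…StrictSha`) and 14 (`…StrictLocalH0`) combined: in rank `0` (`E(K)` finite) with `Ш(E/K)[p^∞]` finite, `p` odd,
`P ⊆ T` finite with `P ⊇ {v ∣ p}`, good reduction and `p ∉ v` outside `T`, and — the one local hypothesis — the `I_v`-fixed points
of `E[p^∞]` FINITE at each `v ∈ T ∖ P` (additive potentially good places: `V_pE^{I_v} = 0`), Kato's `#H¹(O_K[1/p], E[p^k])`
(`= #H¹_ℛ`, `ℛ` everything at `P`, unramified elsewhere) is bounded, for all `k ≥ k₀` and every Poitou–Tate family at level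
`p^k`, by **`#Ш(E/K)[p^∞] · ∏_{v∈T∖P} #E(K_v)[p^∞] · ∏_{v∈P} #𝓚_v`** (`natCard` of Mathlib's `AddCommGroup.primaryComponent` of
`Ш` and of the `K_v`-points; `#𝓚_v = #E(K_v)[p^k]·#(𝓞_v/p^k)`); over `ℚ` with `P = {v_p}`:
**`#H¹_ℛ(ℚ, E[p^k]) ≤ #Ш(E/ℚ)[p^∞] · ∏_{ℓ∈T∖{v_p}} #E(ℚ_ℓ)[p^∞] · #E(ℚ_p)[p^k] · p^k`** — Kato's Prop. 14.16 (2), kernel half,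
with the Tamagawa-type factor read as local `p`-power torsion (`#E(ℚ_ℓ)[p^∞] = c_ℓ^{(p)}` at an additive `ℓ ≠ p`, `p ∤ 6·…`, is
Néron-model input not unfolded here).

References: K. Kato, Astérisque 295 (2004) §14.8, (14.9.3), Prop. 14.16 (2) [Kato2004Asterisque]; J. S. Milne, *ADT* I 2.9, 3.3
[MilneADT2006].
-/

-- the summit and its single problem are both named `BirchSwinnertonDyer` (registry layout D-0017)
set_option linter.dupNamespace false
set_option autoImplicit false

noncomputable section

open scoped Classical ContRepresentation NumberField
open Function Field NumberField IsDedekindDomain WeierstrassCurve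
open Literature.NumberTheory.EllipticCurves Literature.NumberTheory.GaloisRepresentations
  Literature.NumberTheory.GaloisRepresentations.DiscreteGaloisModule Literature.NumberTheory.GaloisCohomology
open Literature.NumberTheory.EllipticCurves.Kato2004
open Summit.BirchSwinnertonDyer.Rank1Residual.X11b.LocBridge

namespace Summit.BirchSwinnertonDyer.BirchSwinnertonDyer.Theorems.KatoFiniteLevelCount

section PointCount

variable {K : Type} [Field K] [NumberField K] (W : WeierstrassCurve K) [W.IsElliptic] (p : ℕ) [Fact p.Prime]

/-- **`#H¹_ℛ(K, E[p^k]) ≤ #Ш(E/K)[p^∞] · ∏_{v∈T∖P} #E(K_v)[p^∞] · ∏_{v∈P} #𝓚_v`** for `k ≥ k₀` (any `K : Type`, rank `0`,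
`Ш(E/K)[p^∞]` finite, `I_v`-fixed points of `E[p^∞]` finite at `v ∈ T ∖ P`; `Kato2004` level dialect `(p:ℤ)^k`).
[cite: Kato2004Asterisque, §14.8 (p. 238), (14.9.3) (p. 240), Prop. 14.16 (2) (p. 244)] -/
theorem exists_forall_le_natCard_selmerGroup_relaxed_le_sha_points_intPow (hodd : p ≠ 2)
    (P T : Finset (HeightOneSpectrum (𝓞 K)))
    (hPT : P ⊆ T) (hT : ∀ v : HeightOneSpectrum (𝓞 K), v ∉ T → (p : 𝓞 K) ∉ v.asIdeal ∧ W.HasGoodReductionAt v)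
    (hPp : ∀ v : HeightOneSpectrum (𝓞 K), (p : 𝓞 K) ∈ v.asIdeal → v ∈ P)
    (hI : ∀ v ∈ T \ P, Set.Finite {x : W.geomPrimaryTorsion p |
      ∀ τ ∈ absInertia (v.adicCompletion K), GaloisRep.toLocal v (primaryGaloisModule W p) τ x = x})
    (𝓢inf 𝓢zero : SelmerStructure (primaryGaloisModule W p)) [Finite W.toAffine.Point]
    [Finite (AddCommGroup.primaryComponent W.sha p)]
    (hIP : ∀ v ∈ P, 𝓢inf (Sum.inr v) = ⊥)
    (hIur : ∀ v ∉ P, 𝓢inf (Sum.inr v) = unramifiedSubgroup (GaloisRep.toLocal v (primaryGaloisModule W p)) 1)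
    (hIinl : ∀ w : InfinitePlace K, 𝓢inf (Sum.inl w) = ⊤)
    (h0T : ∀ v ∈ T, 𝓢zero (Sum.inr v) = ⊥)
    (h0ur : ∀ v ∉ T, 𝓢zero (Sum.inr v) = unramifiedSubgroup (GaloisRep.toLocal v (primaryGaloisModule W p)) 1)
    (h0inl : ∀ w : InfinitePlace K, 𝓢zero (Sum.inl w) = ⊤) {v₀ : HeightOneSpectrum (𝓞 K)} (hv₀P : v₀ ∈ P) :
    ∃ k₀ : ℕ, ∀ k, k₀ ≤ k →
      ∀ (inv : LocalInvariants K (p ^ k)), inv.IsPerfect → inv.SumLocalTermEqZero → inv.SelmerComplement →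
      ∀ (𝓢 ℛ : SelmerStructure (W.torsionGaloisModule ((p : ℤ) ^ k))),
        (∀ v ∈ P, 𝓢 (Sum.inr v) = ⊥) → (∀ v ∈ P, ℛ (Sum.inr v) = ⊤) →
        (∀ v ∉ P, 𝓢 (Sum.inr v) = unramifiedSubgroup (GaloisRep.toLocal v (W.torsionGaloisModule ((p : ℤ) ^ k))) 1) →
        (∀ v ∉ P, ℛ (Sum.inr v) = unramifiedSubgroup (GaloisRep.toLocal v (W.torsionGaloisModule ((p : ℤ) ^ k))) 1) →
        Nat.card ℛ.selmerGroup ≤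
          Nat.card (AddCommGroup.primaryComponent W.sha p) *
            (∏ v ∈ T \ P, Nat.card (AddCommGroup.primaryComponent (W.baseChange (v.adicCompletion K)).toAffine.Point p)) *
            ∏ v ∈ P, Nat.card (W.kummerSelmerStructure ((p : ℤ) ^ k) (Sum.inr v)) := by
  have hprod : ∏ v ∈ T \ P, Nat.card (unramifiedSubgroup (GaloisRep.toLocal v (primaryGaloisModule W p)) 1) =
      ∏ v ∈ T \ P, Nat.card (AddCommGroup.primaryComponent (W.baseChange (v.adicCompletion K)).toAffine.Point p) :=
    Finset.prod_congr rfl fun v hv => natCard_unramifiedSubgroup_primary_eq_natCard_primaryComponent W p v (hI v hv)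
  rw [← hprod]
  exact exists_forall_le_natCard_selmerGroup_relaxed_le_sha_intPow W p hodd P T hPT hT hPp 𝓢inf 𝓢zero hIP hIur hIinl h0T
    h0ur h0inl hv₀P

/-- **Over `ℚ`: `#H¹_ℛ(ℚ, E[p^k]) ≤ #Ш(E/ℚ)[p^∞] · ∏_{ℓ∈T∖{v_p}} #E(ℚ_ℓ)[p^∞] · (#E(ℚ_p)[p^k] · p^k)`** for `k ≥ k₀` (rank `0`,
`Ш(E/ℚ)[p^∞]` finite, `I_ℓ`-fixed points of `E[p^∞]` finite at `ℓ ∈ T ∖ {v_p}`) — Kato's Prop. 14.16 (2), kernel half, every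
factor a classical finite group. [cite: Kato2004Asterisque, §14.8 (p. 238), (14.9.3) (p. 240), Prop. 14.16 (2) (p. 244)] -/
theorem exists_forall_le_natCard_selmerGroup_relaxed_le_sha_points_rat_intPow (W : WeierstrassCurve ℚ) [W.IsElliptic]
    (hodd : p ≠ 2) (T : Finset (HeightOneSpectrum (𝓞 ℚ))) (hpT : primePlace p ∈ T)
    (hT : ∀ v : HeightOneSpectrum (𝓞 ℚ), v ∉ T → W.HasGoodReductionAt v)
    (hI : ∀ v ∈ T \ {primePlace p}, Set.Finite {x : W.geomPrimaryTorsion p |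
      ∀ τ ∈ absInertia (v.adicCompletion ℚ), GaloisRep.toLocal v (primaryGaloisModule W p) τ x = x})
    (𝓢inf 𝓢zero : SelmerStructure (primaryGaloisModule W p)) [Finite W.toAffine.Point]
    [Finite (AddCommGroup.primaryComponent W.sha p)]
    (hIP : 𝓢inf (Sum.inr (primePlace p)) = ⊥)
    (hIur : ∀ v : HeightOneSpectrum (𝓞 ℚ), v ≠ primePlace p →
      𝓢inf (Sum.inr v) = unramifiedSubgroup (GaloisRep.toLocal v (primaryGaloisModule W p)) 1)
    (hIinl : ∀ w : InfinitePlace ℚ, 𝓢inf (Sum.inl w) = ⊤)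
    (h0T : ∀ v ∈ T, 𝓢zero (Sum.inr v) = ⊥)
    (h0ur : ∀ v ∉ T, 𝓢zero (Sum.inr v) = unramifiedSubgroup (GaloisRep.toLocal v (primaryGaloisModule W p)) 1)
    (h0inl : ∀ w : InfinitePlace ℚ, 𝓢zero (Sum.inl w) = ⊤) :
    ∃ k₀ : ℕ, ∀ k, k₀ ≤ k →
      ∀ (inv : LocalInvariants ℚ (p ^ k)), inv.IsPerfect → inv.SumLocalTermEqZero → inv.SelmerComplement →
      ∀ (𝓢 ℛ : SelmerStructure (W.torsionGaloisModule ((p : ℤ) ^ k))),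
        𝓢 (Sum.inr (primePlace p)) = ⊥ → ℛ (Sum.inr (primePlace p)) = ⊤ →
        (∀ v : HeightOneSpectrum (𝓞 ℚ), v ≠ primePlace p →
          𝓢 (Sum.inr v) = unramifiedSubgroup (GaloisRep.toLocal v (W.torsionGaloisModule ((p : ℤ) ^ k))) 1) →
        (∀ v : HeightOneSpectrum (𝓞 ℚ), v ≠ primePlace p →
          ℛ (Sum.inr v) = unramifiedSubgroup (GaloisRep.toLocal v (W.torsionGaloisModule ((p : ℤ) ^ k))) 1) →
        Nat.card ℛ.selmerGroup ≤
          Nat.card (AddCommGroup.primaryComponent W.sha p) *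
            (∏ v ∈ T \ {primePlace p},
              Nat.card (AddCommGroup.primaryComponent (W.baseChange (v.adicCompletion ℚ)).toAffine.Point p)) *
            (Nat.card (nsmulAddMonoidHom (p ^ k) :
              (W.baseChange ((primePlace p).adicCompletion ℚ)).toAffine.Point →+ _).ker * p ^ k) := by
  have hprod : ∏ v ∈ T \ {primePlace p}, Nat.card (unramifiedSubgroup (GaloisRep.toLocal v (primaryGaloisModule W p)) 1) =
      ∏ v ∈ T \ {primePlace p},
        Nat.card (AddCommGroup.primaryComponent (W.baseChange (v.adicCompletion ℚ)).toAffine.Point p) :=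
    Finset.prod_congr rfl fun v hv => natCard_unramifiedSubgroup_primary_eq_natCard_primaryComponent W p v (hI v hv)
  rw [← hprod]
  exact exists_forall_le_natCard_selmerGroup_relaxed_le_sha_rat_intPow p W hodd T hpT hT 𝓢inf 𝓢zero hIP hIur hIinl h0T
    h0ur h0inl

end PointCount

end Summit.BirchSwinnertonDyer.BirchSwinnertonDyer.Theorems.KatoFiniteLevelCount

end
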